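import Literature.NumberTheory.LFunctions.RayClassOfIdealHom
import Literature.NumberTheory.LFunctions.RayClassFunctionalEquation
import Literature.NumberTheory.LFunctions.ClassGroupLFunctionZeroFreeRegion
import HarnessLib

/-!
# The Dirichlet series of `−L'/L(s, χ)` for a ray class character, and `L'/L` on `Re s > 1`

Topic `Literature/NumberTheory/LFunctions`; namespace `Literature.NumberTheory.LFunctions`.  Companion of
`RayClassCharacter.lean` (`rayClassCoeff`, `rayClassLSeries`), `RayClassOfIdealHom.lean` and
`TwistedDedekindCoefficients.lean` (`twistCount`, `twistVonMangoldt`, `vonMangoldtNorm`).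

For a modulus `𝔪 ≠ 0` and prime values `ψ` (`|ψ(𝔭)| ≤ 1` off `𝔪`):

* `rayClassCoeffHom 𝔪 ψ : Ideal (𝓞 K) →*₀ ℂ` — Neukirch's ideal function `𝔞 ↦ χ(𝔞)` (`= 0` unless `𝔞 ≠ 0`
  is prime to `𝔪`) packaged as a homomorphism of monoids with zero (glue definition), so that the tree's
  twisted Dedekind coefficients apply;
* `rayClassLSeries_eq_LSeries_twistCount` — `L(χ, s) = Σ_n (Σ_{𝔑𝔞 = n} χ(𝔞)) n^{-s}` for `Re s > 1`;
* `neg_logDeriv_continuation_eq_LSeries` — for any entire continuation `L` of `L(χ, ·)` and `Re s > 1`: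
  `−L'/L(s) = Σ_n (Σ_{𝔑𝔞 = n} χ(𝔞)Λ_K(𝔞)) n^{-s}`;
* `norm_logDeriv_continuation_le_of_one_lt_re` — `‖L'/L(s)‖ ≤ −ζ_K'/ζ_K(σ) ≤ 1/(σ−1) + 77760(5n_K+2)(log|d_K| + log 4)`
  for `1 < σ = Re s ≤ 2`.

## References

* J. Neukirch, *Algebraic Number Theory*, Springer 1999, Ch. VII §8 (8.1) and §13. [NeukirchANT1999]
* J. C. Lagarias, A. M. Odlyzko, in *Algebraic Number Fields* (1977), §5 (5.1)–(5.3). [LagariasOdlyzko1977]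
-/

noncomputable section

open Complex NumberField IsDedekindDomain Filter Topology Set Finset
open scoped NumberField nonZeroDivisors

namespace Literature.NumberTheory.LFunctions

variable {K : Type*} [Field K] [NumberField K]

/-- **The ideal function `𝔞 ↦ χ(𝔞)` of a character `mod 𝔪`** (`χ(𝔞) = ψ`-power product for `𝔞 ≠ 0` prime to
`𝔪`, `0` otherwise), as a homomorphism of monoids with zero on the ideals of `𝓞 K`.
[cite: NeukirchANT1999, Ch. VII §8 (8.1)] -/
def rayClassCoeffHom (𝔪 : Ideal (𝓞 K)) (ψ : HeightOneSpectrum (𝓞 K) → ℂ) : Ideal (𝓞 K) →*₀ ℂ where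
  toFun := rayClassCoeff 𝔪 ψ
  map_zero' := by rw [Ideal.zero_eq_bot]; exact rayClassCoeff_bot 𝔪 ψ
  map_one' := by
    classical
    have h1 : (1 : Ideal (𝓞 K)) ≠ ⊥ := by rw [Ideal.one_eq_top]; exact top_ne_bot
    rw [rayClassCoeff, if_pos ⟨h1, isCoprime_one_left⟩, Ideal.one_eq_top, idealPow_top]
  map_mul' := fun 𝔞 𝔟 ↦ by
    classical
    by_cases h𝔟 : 𝔟 ≠ ⊥ ∧ IsCoprime 𝔟 𝔪
    · have h : rayClassCoeff 𝔪 ψ 𝔟 = idealPow K ψ 𝔟 := by rw [rayClassCoeff, if_pos h𝔟]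
      rw [rayClassCoeff_mul_of_isCoprime h𝔟.1 h𝔟.2, h]
    · have h1 : rayClassCoeff 𝔪 ψ 𝔟 = 0 := by rw [rayClassCoeff, if_neg h𝔟]
      have h2 : rayClassCoeff 𝔪 ψ (𝔞 * 𝔟) = 0 := by
        rw [rayClassCoeff, if_neg]
        rintro ⟨hne, hcop⟩
        exact h𝔟 ⟨right_ne_zero_of_mul hne, hcop.of_mul_left_right⟩
      rw [h1, h2, mul_zero]

/-- `rayClassCoeffHom 𝔪 ψ 𝔞 = χ(𝔞)` (`= 0` unless `𝔞 ≠ 0` is prime to `𝔪`). [cite: NeukirchANT1999, Ch. VII §8 (8.1)] -/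
@[simp] theorem rayClassCoeffHom_apply (𝔪 : Ideal (𝓞 K)) (ψ : HeightOneSpectrum (𝓞 K) → ℂ) (I : Ideal (𝓞 K)) :
    rayClassCoeffHom 𝔪 ψ I = rayClassCoeff 𝔪 ψ I := rfl

/-- `|χ(𝔞)| ≤ 1` (a character of the finite group `J^𝔪/P^𝔪`, extended by `0`). [cite: NeukirchANT1999, Ch. VII §6 (6.8) Definition] -/
theorem norm_rayClassCoeffHom_le {𝔪 : Ideal (𝓞 K)} (h𝔪 : 𝔪 ≠ ⊥) {ψ : HeightOneSpectrum (𝓞 K) → ℂ}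
    (hψ1 : ∀ v : HeightOneSpectrum (𝓞 K), ¬ 𝔪 ≤ v.asIdeal → ‖ψ v‖ ≤ 1) (I : Ideal (𝓞 K)) :
    ‖rayClassCoeffHom 𝔪 ψ I‖ ≤ 1 :=
  norm_rayClassCoeff_le_one h𝔪 hψ1 I

/-- **`L(χ, s) = Σ_n (Σ_{𝔑𝔞 = n} χ(𝔞)) n^{-s}`** for `Re s > 1` (the sum over ideals regrouped by the norm).
[cite: NeukirchANT1999, Ch. VII §8 (8.1) Proposition] -/
theorem rayClassLSeries_eq_LSeries_twistCount {𝔪 : Ideal (𝓞 K)} (h𝔪 : 𝔪 ≠ ⊥)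
    {ψ : HeightOneSpectrum (𝓞 K) → ℂ} (hψ1 : ∀ v : HeightOneSpectrum (𝓞 K), ¬ 𝔪 ≤ v.asIdeal → ‖ψ v‖ ≤ 1)
    {s : ℂ} (hs : 1 < s.re) :
    rayClassLSeries 𝔪 ψ s = LSeries (NumberField.twistCount K (rayClassCoeffHom 𝔪 ψ)) s := by
  rw [rayClassLSeries, ← (hasSum_ideal_twistCount (rayClassCoeffHom 𝔪 ψ) (norm_rayClassCoeffHom_le h𝔪 hψ1) hs).tsum_eq]
  rfl

/-- **`−L'/L(s) = Σ_n (Σ_{𝔑𝔞 = n} χ(𝔞) Λ_K(𝔞)) n^{-s}` for `Re s > 1`**, for any entire continuation `L` of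
`L(χ, ·)`. [cite: LagariasOdlyzko1977, §5 (5.2)] -/
theorem neg_logDeriv_continuation_eq_LSeries {𝔪 : Ideal (𝓞 K)} (h𝔪 : 𝔪 ≠ ⊥)
    {ψ : HeightOneSpectrum (𝓞 K) → ℂ} (hψ1 : ∀ v : HeightOneSpectrum (𝓞 K), ¬ 𝔪 ≤ v.asIdeal → ‖ψ v‖ ≤ 1)
    {L : ℂ → ℂ} (hLs : ∀ s : ℂ, 1 < s.re → L s = rayClassLSeries 𝔪 ψ s) {s : ℂ} (hs : 1 < s.re) :
    -(deriv L s / L s) = LSeries (NumberField.twistVonMangoldt K (rayClassCoeffHom 𝔪 ψ)) s := by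
  set ν := rayClassCoeffHom 𝔪 ψ with hν
  have hν1 : ∀ I, ‖ν I‖ ≤ 1 := norm_rayClassCoeffHom_le h𝔪 hψ1
  have heq : L =ᶠ[𝓝 s] LSeries (NumberField.twistCount K ν) := by
    filter_upwards [(continuous_re.isOpen_preimage _ isOpen_Ioi).mem_nhds (by simpa using hs)] with z hz
    rw [hLs z hz, rayClassLSeries_eq_LSeries_twistCount h𝔪 hψ1 hz]
  rw [heq.deriv_eq, heq.eq_of_nhds, NumberField.logDeriv_LSeries_twistCount hν1 hs, neg_neg]

/-- **`‖L'/L(s)‖ ≤ −ζ_K'/ζ_K(σ) ≤ 1/(σ − 1) + 77760 (5 n_K + 2)(log|d_K| + log 4)`** for `1 < σ = Re s ≤ 2`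
and any entire continuation `L` of `L(χ, ·)` (termwise `|χ(𝔞)Λ_K(𝔞)| ≤ Λ_K(𝔞)` and the tree's Stark-type
bound for `−ζ_K'/ζ_K(σ)`). [cite: LagariasOdlyzko1977, §5 (5.3)] -/
theorem norm_logDeriv_continuation_le_of_one_lt_re {𝔪 : Ideal (𝓞 K)} (h𝔪 : 𝔪 ≠ ⊥)
    {ψ : HeightOneSpectrum (𝓞 K) → ℂ} (hψ1 : ∀ v : HeightOneSpectrum (𝓞 K), ¬ 𝔪 ≤ v.asIdeal → ‖ψ v‖ ≤ 1)
    {L : ℂ → ℂ} (hLs : ∀ s : ℂ, 1 < s.re → L s = rayClassLSeries 𝔪 ψ s) {s : ℂ} (hs : 1 < s.re)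
    (hs2 : s.re ≤ 2) :
    ‖logDeriv L s‖ ≤ 1 / (s.re - 1) + 77760 * (5 * Module.finrank ℚ K + 2) *
      (Real.log ((discr K).natAbs : ℝ) + Real.log 4) := by
  set ν := rayClassCoeffHom 𝔪 ψ with hν
  have hν1 : ∀ I, ‖ν I‖ ≤ 1 := norm_rayClassCoeffHom_le h𝔪 hψ1
  rw [logDeriv_apply, ← norm_neg, neg_logDeriv_continuation_eq_LSeries h𝔪 hψ1 hLs hs]
  have h1 := TwistedZFR.norm_LSeries_le_of_norm_le (NumberField.norm_twistVonMangoldt_le hν1)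
    (fun s hs ↦ NumberField.LSeriesSummable_vonMangoldtNorm hs) (s := s) (σ' := s.re) hs le_rfl
  have h2 := NumberField.re_LSeries_vonMangoldtNorm_ofReal_le (K := K) hs hs2
  exact h1.trans h2

end Literature.NumberTheory.LFunctions
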